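import Literature.AlgebraicGeometry.Motives.NumericallyTrivialCorrespondencesNilpotent
import Literature.AlgebraicGeometry.Motives.KunnethProjectorsAbelianVarieties
import Literature.AlgebraicGeometry.Motives.KatzMessingKunnethProjectors
import Literature.AlgebraicGeometry.Motives.AbelianVarietyProjectiveChart
import HarnessLib

/-!
# Jannsen's Corollary 1 in the known cases of `C(X)`: curves, abelian varieties, products,
# finite fields

U. Jannsen, *Motives, numerical equivalence, and semi-simplicity*, Invent. Math. 107 (1992),
Corollary 1: if the Künneth components of the diagonal of `X` are algebraic, the numerically
trivial correspondences of degree `0` on `X × X` form the (nilpotent) Jacobson radical of the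
algebra of homological correspondences — in the tree
`WeilCohomology.numericallyTrivial_eq_jacobson (hC : W.StandardConjectureC n X)`
(`NumericallyTrivialCorrespondencesNilpotent`). Jannsen, Remarks 1) (p. 451): "The assumption of
Corollary 1 is fulfilled if `dim X ≤ 2` ([M]) or if `X` is an abelian variety (by results of
Lieberman, cf. [K] Sect. 2 appendix), and for all `X` if `k` is (contained in the algebraic
closure of) a finite field ([KM]). Moreover, if the assumption holds for `X` and `Y`, it also
holds for `X × Y`, since `πⱼ = Σ_{r+s=j} π_r ⊗ π_s` by the Künneth formula."

With the Künneth projectors now algebraic in the tree for curves (`standardConjectureC_curve`),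
abelian varieties for **every** Weil cohomology theory (`standardConjectureC_abelianVariety`, no
hard Lefschetz, improving on the tree's `numericallyTrivial_eq_jacobson_abelianVariety` which
assumes `W.HasHardLefschetz`), products (`standardConjectureC_tensor`) and varieties over a
finite field under Frobenius-through-`φ` and the Riemann hypothesis
(`GaloisWeilCohomology.standardConjectureC_of_weilRiemannHypothesisFor`), this file records
Corollary 1 in these cases (`dim X = 2` needs Murre's `π¹`, not available for an abstract `W`).
Since an abelian variety is smooth projective of dimension `dim A` over any field
(`AbelianVariety.isSmoothProjective_holds`, `AbelianVarietyProjectiveChart`), the abelian case is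
also recorded free of every hypothesis: `standardConjectureC_abelianVariety_dim`,
`numericallyTrivial_eq_jacobson_abelianVariety_dim`.

Theorems only; nothing restated.

## References

* [Jannsen1992Motives] U. Jannsen, *Motives, numerical equivalence, and semi-simplicity*, Invent.
  Math. 107 (1992), 447–452, Cor. 1 and Remarks 1) (p. 451).
* [Kleiman1968AlgebraicCycles] S. Kleiman, *Algebraic cycles and the Weil conjectures* (1968),
  Appendix to §2.
* [KatzMessing1974] N. M. Katz, W. Messing, Invent. Math. 23 (1974), Thm. 2 (1).
-/

universe u v

open CategoryTheory AlgebraicGeometry MonoidalCategory CartesianMonoidalCategory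

noncomputable section

namespace Literature.AlgebraicGeometry.Motives

namespace WeilCohomology

variable {k : Type u} [Field k] {K : Type v} [Field K] [CharZero K] (W : WeilCohomology k K)

/-! ## Curves -/

/-- **Jannsen Cor. 1 for curves** ("fulfilled if `dim X ≤ 2`", here `dim X = 1`): for a smooth
projective curve `X` and every Weil cohomology theory, the numerically trivial correspondences of
degree `0` on `X × X` form the Jacobson radical of `B¹(X × X)_K`.
[cite: Jannsen1992Motives, Cor. 1 and Remark 1 (p. 451)] -/
theorem numericallyTrivial_eq_jacobson_curve {X : SchemeOver k} (hX : IsSmoothProjective 1 X) :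
    (W.numericallyTrivial 1 X).asIdeal = Ring.jacobson (W.homCorrAlgebra 1 X) :=
  W.numericallyTrivial_eq_jacobson hX (W.standardConjectureC_curve hX)

/-- For a curve the numerically trivial ideal is nilpotent, for every `W`.
[cite: Jannsen1992Motives, Cor. 1 and Remark 1 (p. 451)] -/
theorem isNilpotent_numericallyTrivial_curve {X : SchemeOver k} (hX : IsSmoothProjective 1 X) :
    IsNilpotent (W.numericallyTrivial 1 X).asIdeal :=
  W.isNilpotent_numericallyTrivial hX (W.standardConjectureC_curve hX)

/-! ## Abelian varieties (every Weil cohomology theory) -/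

section AbelianVariety

variable {g : ℕ} (A : AbelianVariety k)

/-- **Jannsen Cor. 1 for abelian varieties, for every Weil cohomology theory** ("fulfilled … if
`X` is an abelian variety (by results of Lieberman, cf. [K] Sect. 2 appendix)"): the numerically
trivial degree-`0` correspondences on `A × A` form the Jacobson radical of `Bᵍ(A × A)_K`. No hard
Lefschetz hypothesis (contrast `numericallyTrivial_eq_jacobson_abelianVariety`).
[cite: Jannsen1992Motives, Cor. 1 and Remark 1 (p. 451)] [cite: Kleiman1968AlgebraicCycles, Appendix to §2] -/
theorem numericallyTrivial_eq_jacobson_abelianVariety_of_isSmoothProjective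
    (hA : IsSmoothProjective g A.X) :
    (W.numericallyTrivial g A.X).asIdeal = Ring.jacobson (W.homCorrAlgebra g A.X) :=
  W.numericallyTrivial_eq_jacobson hA (W.standardConjectureC_abelianVariety A hA)

/-- The numerically trivial ideal of `Bᵍ(A × A)_K` is nilpotent, for every `W`.
[cite: Jannsen1992Motives, Cor. 1 and Remark 1 (p. 451)] -/
theorem isNilpotent_numericallyTrivial_abelianVariety (hA : IsSmoothProjective g A.X) :
    IsNilpotent (W.numericallyTrivial g A.X).asIdeal :=
  W.isNilpotent_numericallyTrivial hA (W.standardConjectureC_abelianVariety A hA)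

/-- On an abelian variety a numerically trivial degree-`0` correspondence is nilpotent, for every
`W` (Jannsen Cor. 1: "`f` numerically trivial ⇒ `f` nilpotent"). [cite: Jannsen1992Motives, Cor. 1] -/
theorem isNilpotent_of_mem_numericallyTrivial_abelianVariety (hA : IsSmoothProjective g A.X)
    {f : W.homCorrAlgebra g A.X} (hf : f ∈ W.numericallyTrivial g A.X) : IsNilpotent f :=
  W.isNilpotent_of_mem_numericallyTrivial hA (W.standardConjectureC_abelianVariety A hA) hf

/-- On an abelian variety, `f` is numerically trivial iff the two-sided ideal it generates is nil,
for every `W`. [cite: Jannsen1992Motives, Cor. 1] -/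
theorem mem_numericallyTrivial_iff_forall_isNilpotent_abelianVariety (hA : IsSmoothProjective g A.X)
    (f : W.homCorrAlgebra g A.X) :
    f ∈ W.numericallyTrivial g A.X ↔ ∀ a b : W.homCorrAlgebra g A.X, IsNilpotent (a * f * b) :=
  W.mem_numericallyTrivial_iff_forall_isNilpotent hA (W.standardConjectureC_abelianVariety A hA) f

end AbelianVariety

/-! ## Abelian varieties, unconditionally (`g = dim A`) -/

section AbelianVarietyDim

variable (A : AbelianVariety k)

/-- **`C(A)` for every abelian variety over every field and every Weil cohomology theory**, with no
hypothesis at all: the Künneth projectors of `A` are algebraic (Lieberman–Kleiman, Thm. 2A11, via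
`[2]^* = 2ⁱ` on `Hⁱ(A)`; smooth projectivity of `A` of dimension `dim A` from
`AbelianVariety.isSmoothProjective_holds`). [cite: Kleiman1968AlgebraicCycles, Appendix to §2, Thm. 2A11] -/
theorem standardConjectureC_abelianVariety_dim : W.StandardConjectureC A.dim A.X :=
  W.standardConjectureC_abelianVariety A
    (AbelianVariety.isSmoothProjective_holds (A := A) : IsSmoothProjective A.dim A.X)

/-- The identity of each `Hⁱ(A)` is an algebraic operator, for every abelian variety and every `W`.
[cite: Kleiman1968AlgebraicCycles, Appendix to §2, Thm. 2A11] -/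
theorem isAlgebraicOperator_id_abelianVariety_dim (i : ℕ) :
    W.IsAlgebraicOperator A.dim A.dim (LinearMap.id : W.obj A.X i →ₗ[K] W.obj A.X i) :=
  W.isAlgebraicOperator_id_abelianVariety A
    (AbelianVariety.isSmoothProjective_holds (A := A) : IsSmoothProjective A.dim A.X) i

/-- `C(A × B)` for abelian varieties `A`, `B` over any field, every `W`, no hypotheses.
[cite: Kleiman1968AlgebraicCycles, Appendix to §2, Thm. 2A11] [cite: Jannsen1992Motives, Remark 1 (p. 451)] -/
theorem standardConjectureC_abelianVariety_tensor_abelianVariety_dim (B : AbelianVariety k) :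
    W.StandardConjectureC (A.dim + B.dim) (A.X ⊗ B.X) :=
  W.standardConjectureC_abelianVariety_tensor_abelianVariety A
    (AbelianVariety.isSmoothProjective_holds (A := A) : IsSmoothProjective A.dim A.X) B
    (AbelianVariety.isSmoothProjective_holds (A := B) : IsSmoothProjective B.dim B.X)

/-- **Jannsen Cor. 1 for every abelian variety and every Weil cohomology theory, no hypotheses**:
the numerically trivial degree-`0` correspondences on `A × A` form the Jacobson radical of
`B^{dim A}(A × A)_K` (the tree's `numericallyTrivial_eq_jacobson_abelianVariety` assumes hard
Lefschetz and a hyperplane class). [cite: Jannsen1992Motives, Cor. 1 and Remark 1 (p. 451)] -/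
theorem numericallyTrivial_eq_jacobson_abelianVariety_dim :
    (W.numericallyTrivial A.dim A.X).asIdeal = Ring.jacobson (W.homCorrAlgebra A.dim A.X) :=
  W.numericallyTrivial_eq_jacobson_abelianVariety_of_isSmoothProjective A
    AbelianVariety.isSmoothProjective_holds

/-- The numerically trivial ideal of `B^{dim A}(A × A)_K` is nilpotent, for every abelian variety
and every `W`. [cite: Jannsen1992Motives, Cor. 1 and Remark 1 (p. 451)] -/
theorem isNilpotent_numericallyTrivial_abelianVariety_dim :
    IsNilpotent (W.numericallyTrivial A.dim A.X).asIdeal :=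
  W.isNilpotent_numericallyTrivial_abelianVariety A AbelianVariety.isSmoothProjective_holds

/-- On every abelian variety, numerically trivial degree-`0` correspondences are nilpotent, for
every `W`. [cite: Jannsen1992Motives, Cor. 1] -/
theorem isNilpotent_of_mem_numericallyTrivial_abelianVariety_dim {f : W.homCorrAlgebra A.dim A.X}
    (hf : f ∈ W.numericallyTrivial A.dim A.X) : IsNilpotent f :=
  W.isNilpotent_of_mem_numericallyTrivial_abelianVariety A AbelianVariety.isSmoothProjective_holds hf

end AbelianVarietyDim

/-! ## Products -/

/-- **Jannsen Cor. 1 is stable under products** ("if the assumption holds for `X` and `Y`, it also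
holds for `X × Y`"): under `C(X)` and `C(Z)` the numerically trivial degree-`0` correspondences on
`(X × Z) × (X × Z)` form the Jacobson radical. [cite: Jannsen1992Motives, Remark 1 (p. 451)] -/
theorem numericallyTrivial_eq_jacobson_tensor {n m : ℕ} {X Z : SchemeOver k}
    (hX : IsSmoothProjective n X) (hZ : IsSmoothProjective m Z) (hCX : W.StandardConjectureC n X)
    (hCZ : W.StandardConjectureC m Z) :
    (W.numericallyTrivial (n + m) (X ⊗ Z)).asIdeal = Ring.jacobson (W.homCorrAlgebra (n + m) (X ⊗ Z)) :=
  W.numericallyTrivial_eq_jacobson (isSmoothProjective_tensor hX hZ)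
    (W.standardConjectureC_tensor hX hZ hCX hCZ)

/-- Products of curves and abelian varieties: Cor. 1 for `A × X`, `X` a curve, every `W`.
[cite: Jannsen1992Motives, Remark 1 (p. 451)] -/
theorem numericallyTrivial_eq_jacobson_abelianVariety_tensor_curve {g : ℕ} (A : AbelianVariety k)
    (hA : IsSmoothProjective g A.X) {X : SchemeOver k} (hX : IsSmoothProjective 1 X) :
    (W.numericallyTrivial (g + 1) (A.X ⊗ X)).asIdeal =
      Ring.jacobson (W.homCorrAlgebra (g + 1) (A.X ⊗ X)) :=
  W.numericallyTrivial_eq_jacobson (isSmoothProjective_tensor hA hX)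
    (W.standardConjectureC_abelianVariety_tensor_curve A hA hX)

end WeilCohomology

/-! ## Finite fields -/

namespace GaloisWeilCohomology

variable {k : Type u} [Field k] [Finite k] {K : Type v} [Field K] [CharZero K]
  {χ : Field.absoluteGaloisGroup k →* Kˣ} (E : GaloisWeilCohomology k K χ)
variable {n : ℕ} {X : SchemeOver k}

/-- **Jannsen Cor. 1 over a finite field** ("for all `X` if `k` is … a finite field ([KM])"): for
`X` smooth projective over the finite field `k`, with the geometric Frobenius acting through a
`k`-endomorphism `φ` and the Riemann hypothesis (Katz–Messing Thm. 2 (1), `C(X)`), the numerically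
trivial degree-`0` correspondences form the nilpotent Jacobson radical of `Bⁿ(X × X)_K`.
[cite: Jannsen1992Motives, Cor. 1 and Remark 1 (p. 451)] [cite: KatzMessing1974, Thm. 2 (1)] -/
theorem numericallyTrivial_eq_jacobson_of_weilRiemannHypothesisFor (hX : IsSmoothProjective n X)
    (φ : X ⟶ X) (hφ : ∀ i : ℕ, E.frobAction X i = E.pullback φ i)
    (hRH : E.WeilRiemannHypothesisFor X n) :
    (E.numericallyTrivial n X).asIdeal = Ring.jacobson (E.homCorrAlgebra n X) :=
  E.numericallyTrivial_eq_jacobson hX (E.standardConjectureC_of_weilRiemannHypothesisFor hX φ hφ hRH)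

/-- Over a finite field (Frobenius through `φ`, Riemann hypothesis) the numerically trivial ideal is
nilpotent and numerically trivial correspondences are nilpotent.
[cite: Jannsen1992Motives, Cor. 1 and Remark 1 (p. 451)] [cite: KatzMessing1974, Thm. 2 (1)] -/
theorem isNilpotent_numericallyTrivial_of_weilRiemannHypothesisFor (hX : IsSmoothProjective n X)
    (φ : X ⟶ X) (hφ : ∀ i : ℕ, E.frobAction X i = E.pullback φ i)
    (hRH : E.WeilRiemannHypothesisFor X n) :
    IsNilpotent (E.numericallyTrivial n X).asIdeal :=
  E.isNilpotent_numericallyTrivial hX (E.standardConjectureC_of_weilRiemannHypothesisFor hX φ hφ hRH)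

/-- Jannsen Cor. 1, elementwise, over a finite field. [cite: Jannsen1992Motives, Cor. 1] -/
theorem isNilpotent_of_mem_numericallyTrivial_of_weilRiemannHypothesisFor
    (hX : IsSmoothProjective n X) (φ : X ⟶ X) (hφ : ∀ i : ℕ, E.frobAction X i = E.pullback φ i)
    (hRH : E.WeilRiemannHypothesisFor X n) {f : E.homCorrAlgebra n X}
    (hf : f ∈ E.numericallyTrivial n X) : IsNilpotent f :=
  E.isNilpotent_of_mem_numericallyTrivial hX
    (E.standardConjectureC_of_weilRiemannHypothesisFor hX φ hφ hRH) hf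

end GaloisWeilCohomology

end Literature.AlgebraicGeometry.Motives

end
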